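import Mathlib
import Summits.RiemannHypothesis.RiemannHypothesis.Theorems.IntegerScrewExitAtomGreen
import HarnessLib

/-!
# Route `IntegerScrew` — the exit-death flow on the TRUE cells of THEOREM P₀: divergence and Cauchy–Schwarz
# on the `p`-free atom (CONTINUUM-LIMIT §25.10 (a), §25.11 (a)–(c): THEOREM B/C's flow half in the kernel)

Continuation of `IntegerScrewExitAtomGreen` (notation there: `𝒜 = Nat.smoothNumbers p ∩ [1, R]`,
`W = 𝒜 ∩ (Q, R]`, `B = 𝒜 ∩ [1, Q]`, `Γ_𝒜 = exitGammaAtom R Q p`, `ν^𝒜 = exitInflowAtom R Q p`):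

* `sum_smooth_divisors_reindex` — `Σ_{x∈𝒜}Σ_{n∣x} h(x,n) = Σ_{y∈𝒜}Σ_{n ≤ R/y, n p-free} h(yn, n)`;
* **`exit_flow_divergence_atom`** — `div F = σ_W − ν^𝒜` on the atom, for EVERY window `1 ≤ Q ≤ R`:
  `Σ_{x∈𝒜}Σ_{n∣x}(Γ_𝒜(x)/x)(Λ(n)/log x)(g(x) − g(x/n)) = Σ_{W} g/x − Σ_{B} ν^𝒜(b)g(b)`;
  `sum_exitInflowAtom_eq` — conservation `Σ_B ν^𝒜 = Σ_{W} 1/x`;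
* **`exit_flow_cauchy_schwarz_atom`** — `(Σ_{W} g/x − Σ_{B} ν^𝒜 g)² ≤ [Σ_{Q<x≤R} Γ_𝒜²/(x log x)]·D_𝒜(g)`
  with `D_𝒜(g) = Σ_{x∈𝒜}(1/x)Σ_{n∣x}Λ(n)(g(x) − g(x/n))²` the atom's INTERNAL Dirichlet form (the right-hand
  side of THEOREM P₀'s cell hypothesis), and, through `Γ_𝒜 ≤ Γ` and `sum_exitGamma_sq_div_le`,
  **`exit_flow_cauchy_schwarz_atom_explicit`**: the bracket is `≤ A² log²R·(1/(2log²Q) − 1/(2log²R))` for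
  `2 ≤ Q ≤ R` and the pointwise Green bound `Γ ≤ A log R/log x` on `(Q, R]` — the flow half of THEOREMS B and C with
  explicit elementary constants, for every window of every `p`-free atom.

RH-free, elementary.  Nothing in this file bears on the truth of RH.
References: CONTINUUM-LIMIT §25.10–25.11 (rh-explicit A6-PIVOT); M. Suzuki, J. Lond. Math. Soc. (2) 108 (2023)
1448–1487 [Suzuki2023].
-/

noncomputable section

set_option linter.dupNamespace false -- D-0017: `Summit.<S>.<S>.…` is the designed namespace

namespace Summit.RiemannHypothesis.RiemannHypothesis.Theorems.IntegerScrew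

open Finset Real
open ArithmeticFunction (vonMangoldt)

/-! ### Reindexing inside the atom -/

/-- `Σ_{x ≤ R, x p-free} Σ_{n ∣ x} h(x,n) = Σ_{y ≤ R, y p-free} Σ_{n ≤ R/y, n p-free} h(yn, n)`
(`yn` is `p`-free iff both factors are). -/
theorem sum_smooth_divisors_reindex (R p : ℕ) (h : ℕ → ℕ → ℝ) :
    ∑ x ∈ (Icc 1 R).filter (· ∈ Nat.smoothNumbers p), ∑ n ∈ x.divisors, h x n =
      ∑ y ∈ (Icc 1 R).filter (· ∈ Nat.smoothNumbers p),
        ∑ n ∈ (Icc 1 (R / y)).filter (· ∈ Nat.smoothNumbers p), h (y * n) n := by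
  have key := sum_divisors_reindex R (fun x n => if x ∈ Nat.smoothNumbers p then h x n else 0)
  rw [Finset.sum_filter]
  have hL : ∑ x ∈ Icc 1 R, (if x ∈ Nat.smoothNumbers p then ∑ n ∈ x.divisors, h x n else 0) =
      ∑ x ∈ Icc 1 R, ∑ n ∈ x.divisors, (if x ∈ Nat.smoothNumbers p then h x n else 0) := by
    refine Finset.sum_congr rfl fun x _ => ?_
    split_ifs <;> simp
  rw [hL, key, Finset.sum_filter]
  refine Finset.sum_congr rfl fun y _ => ?_
  by_cases hys : y ∈ Nat.smoothNumbers p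
  · rw [if_pos hys, Finset.sum_filter]
    refine Finset.sum_congr rfl fun n _ => ?_
    by_cases hns : n ∈ Nat.smoothNumbers p
    · rw [if_pos hns, if_pos (Nat.mul_mem_smoothNumbers hys hns)]
    · rw [if_neg hns, if_neg]
      intro hyn
      exact hns (Nat.mem_smoothNumbers_of_dvd hyn (Dvd.intro_left y rfl))
  · rw [if_neg hys]
    refine Finset.sum_eq_zero fun n _ => ?_
    rw [if_neg]
    intro hyn
    exact hys (Nat.mem_smoothNumbers_of_dvd hyn (Dvd.intro n rfl))

/-! ### The divergence identity on the atom -/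

/-- **`div F = σ_W − ν^𝒜` on the `p`-free atom**, for every window `1 ≤ Q ≤ R` and every `g`:
`Σ_{x∈𝒜}Σ_{n∣x} (Γ_𝒜(x)/x)(Λ(n)/log x)(g(x) − g(x/n)) = Σ_{x∈𝒜, Q<x≤R} g(x)/x − Σ_{b∈𝒜, b≤Q} ν^𝒜(b)g(b)`. -/
theorem exit_flow_divergence_atom {R Q : ℕ} (p : ℕ) (hQ : 1 ≤ Q) (hQR : Q ≤ R) (g : ℕ → ℝ) :
    ∑ x ∈ (Icc 1 R).filter (· ∈ Nat.smoothNumbers p), ∑ n ∈ x.divisors,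
        exitGammaAtom R Q p x / x * (vonMangoldt n / Real.log x) * (g x - g (x / n)) =
      ∑ x ∈ (Ioc Q R).filter (· ∈ Nat.smoothNumbers p), g x / x -
        ∑ b ∈ (Icc 1 Q).filter (· ∈ Nat.smoothNumbers p), exitInflowAtom R Q p b * g b := by
  -- out-part: Σ_{n ∣ x} Λ(n) = log x
  have hout : ∀ x ∈ (Icc 1 R).filter (· ∈ Nat.smoothNumbers p), ∑ n ∈ x.divisors,
      exitGammaAtom R Q p x / x * (vonMangoldt n / Real.log x) * g x = exitGammaAtom R Q p x / x * g x := by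
    intro x _
    by_cases hW : Q < x ∧ x ≤ R
    · have hx2 : (2 : ℝ) ≤ x := by exact_mod_cast (show 2 ≤ x by omega)
      have hlog : Real.log x ≠ 0 := (Real.log_pos (by linarith)).ne'
      rw [← Finset.sum_mul, ← Finset.mul_sum, ← Finset.sum_div, ArithmeticFunction.vonMangoldt_sum,
        div_self hlog, mul_one]
    · simp [exitGammaAtom_of_not_mem hW]
  -- in-part: reindex over (y, n) with x = y n, both p-free
  have hin : ∑ x ∈ (Icc 1 R).filter (· ∈ Nat.smoothNumbers p), ∑ n ∈ x.divisors,
      exitGammaAtom R Q p x / x * (vonMangoldt n / Real.log x) * g (x / n) =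
      ∑ y ∈ (Icc 1 R).filter (· ∈ Nat.smoothNumbers p), exitInflowAtom R Q p y * g y := by
    rw [sum_smooth_divisors_reindex R p
      (fun x n => exitGammaAtom R Q p x / x * (vonMangoldt n / Real.log x) * g (x / n))]
    refine Finset.sum_congr rfl fun y _ => ?_
    unfold exitInflowAtom
    rw [Finset.sum_mul]
    refine Finset.sum_congr rfl fun n hn => ?_
    have hn0 : n ≠ 0 := by have := (mem_Icc.1 (Finset.mem_filter.1 hn).1).1; omega
    rw [Nat.mul_div_cancel _ (Nat.pos_of_ne_zero hn0)]
  have hsplit : ∀ x ∈ (Icc 1 R).filter (· ∈ Nat.smoothNumbers p), ∑ n ∈ x.divisors,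
      exitGammaAtom R Q p x / x * (vonMangoldt n / Real.log x) * (g x - g (x / n)) =
      ∑ n ∈ x.divisors, exitGammaAtom R Q p x / x * (vonMangoldt n / Real.log x) * g x -
        ∑ n ∈ x.divisors, exitGammaAtom R Q p x / x * (vonMangoldt n / Real.log x) * g (x / n) := by
    intro x _
    rw [← Finset.sum_sub_distrib]
    exact Finset.sum_congr rfl fun n _ => by ring
  rw [Finset.sum_congr rfl hsplit, Finset.sum_sub_distrib, Finset.sum_congr rfl hout, hin]
  -- split [1, R] = [1, Q] ∪ (Q, R] inside the filter
  have hIcc : (Icc 1 R).filter (· ∈ Nat.smoothNumbers p) =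
      (Icc 1 Q).filter (· ∈ Nat.smoothNumbers p) ∪ (Ioc Q R).filter (· ∈ Nat.smoothNumbers p) := by
    rw [← Finset.filter_union]
    congr 1
    ext x; simp only [Finset.mem_union, Finset.mem_Icc, Finset.mem_Ioc]; omega
  have hdisj : Disjoint ((Icc 1 Q).filter (· ∈ Nat.smoothNumbers p))
      ((Ioc Q R).filter (· ∈ Nat.smoothNumbers p)) := by
    rw [Finset.disjoint_left]; intro x hx hx'
    have := Finset.mem_Icc.1 (Finset.mem_filter.1 hx).1
    have := Finset.mem_Ioc.1 (Finset.mem_filter.1 hx').1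
    omega
  rw [hIcc, Finset.sum_union hdisj, Finset.sum_union hdisj]
  have hB : ∑ x ∈ (Icc 1 Q).filter (· ∈ Nat.smoothNumbers p), exitGammaAtom R Q p x / x * g x = 0 := by
    refine Finset.sum_eq_zero fun x hx => ?_
    have : ¬(Q < x ∧ x ≤ R) := by
      have := Finset.mem_Icc.1 (Finset.mem_filter.1 hx).1; omega
    simp [exitGammaAtom_of_not_mem this]
  have hWin : ∑ x ∈ (Ioc Q R).filter (· ∈ Nat.smoothNumbers p), exitInflowAtom R Q p x * g x =
      ∑ x ∈ (Ioc Q R).filter (· ∈ Nat.smoothNumbers p), exitGammaAtom R Q p x / x * g x -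
        ∑ x ∈ (Ioc Q R).filter (· ∈ Nat.smoothNumbers p), g x / x := by
    rw [← Finset.sum_sub_distrib]
    refine Finset.sum_congr rfl fun x hx => ?_
    have hx' := Finset.mem_Ioc.1 (Finset.mem_filter.1 hx).1
    rw [exitInflowAtom_eq_of_mem ⟨hx'.1, hx'.2⟩]
    ring
  rw [hB, hWin]
  ring

/-- Conservation: the atom's exit measure has total mass `Σ_{x ∈ W∩𝒜} 1/x`. -/
theorem sum_exitInflowAtom_eq {R Q : ℕ} (p : ℕ) (hQ : 1 ≤ Q) (hQR : Q ≤ R) :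
    ∑ b ∈ (Icc 1 Q).filter (· ∈ Nat.smoothNumbers p), exitInflowAtom R Q p b =
      ∑ x ∈ (Ioc Q R).filter (· ∈ Nat.smoothNumbers p), (1 : ℝ) / x := by
  have h := exit_flow_divergence_atom p hQ hQR (fun _ => (1 : ℝ))
  simp only [sub_self, mul_zero, Finset.sum_const_zero, mul_one] at h
  linarith

/-! ### The flow form of Cauchy–Schwarz on the atom -/

/-- **Thomson / Cauchy–Schwarz for the exit-death flow on the `p`-free atom** (`1 ≤ Q ≤ R`):
`(Σ_{x∈𝒜, Q<x≤R} g(x)/x − Σ_{b∈𝒜, b≤Q} ν^𝒜(b)g(b))² ≤ [Σ_{Q<x≤R} Γ_𝒜(x)²/(x log x)] · D_𝒜(g)`,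
`D_𝒜(g) = Σ_{x∈𝒜}(1/x)Σ_{n∣x}Λ(n)(g(x) − g(x/n))²` the atom's internal Dirichlet form. -/
theorem exit_flow_cauchy_schwarz_atom {R Q : ℕ} (p : ℕ) (hQ : 1 ≤ Q) (hQR : Q ≤ R) (g : ℕ → ℝ) :
    (∑ x ∈ (Ioc Q R).filter (· ∈ Nat.smoothNumbers p), g x / x -
        ∑ b ∈ (Icc 1 Q).filter (· ∈ Nat.smoothNumbers p), exitInflowAtom R Q p b * g b) ^ 2 ≤
      (∑ x ∈ Ioc Q R, exitGammaAtom R Q p x ^ 2 / (x * Real.log x)) *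
        ∑ x ∈ (Icc 1 R).filter (· ∈ Nat.smoothNumbers p),
          (1 / (x : ℝ)) * ∑ n ∈ x.divisors, vonMangoldt n * (g x - g (x / n)) ^ 2 := by
  rw [← exit_flow_divergence_atom p hQ hQR g]
  set S := ((Icc 1 R).filter (· ∈ Nat.smoothNumbers p)).sigma fun x => x.divisors with hS
  have hflat : ∑ x ∈ (Icc 1 R).filter (· ∈ Nat.smoothNumbers p), ∑ n ∈ x.divisors,
      exitGammaAtom R Q p x / x * (vonMangoldt n / Real.log x) * (g x - g (x / n)) =
      ∑ q ∈ S, exitGammaAtom R Q p q.1 / q.1 * (vonMangoldt q.2 / Real.log q.1) * (g q.1 - g (q.1 / q.2)) := by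
    rw [Finset.sum_sigma]
  -- the energy over the atom is ≤ the energy bracket over all of (Q, R]
  have hE : ∑ q ∈ S, (1 / (q.1 : ℝ)) * vonMangoldt q.2 * (exitGammaAtom R Q p q.1 / Real.log q.1) ^ 2 ≤
      ∑ x ∈ Ioc Q R, exitGammaAtom R Q p x ^ 2 / (x * Real.log x) := by
    rw [hS, Finset.sum_sigma]
    have hterm : ∀ x ∈ (Icc 1 R).filter (· ∈ Nat.smoothNumbers p),
        ∑ n ∈ x.divisors, (1 / (x : ℝ)) * vonMangoldt n * (exitGammaAtom R Q p x / Real.log x) ^ 2 =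
          if Q < x then exitGammaAtom R Q p x ^ 2 / (x * Real.log x) else 0 := by
      intro x _
      by_cases hW : Q < x
      · rw [if_pos hW]
        have hx2 : (2 : ℝ) ≤ x := by exact_mod_cast (show 2 ≤ x by omega)
        have hlog : Real.log x ≠ 0 := (Real.log_pos (by linarith)).ne'
        have hx0 : (x : ℝ) ≠ 0 := by positivity
        have : ∑ n ∈ x.divisors, (1 / (x : ℝ)) * vonMangoldt n * (exitGammaAtom R Q p x / Real.log x) ^ 2 =
            (1 / (x : ℝ)) * (exitGammaAtom R Q p x / Real.log x) ^ 2 * ∑ n ∈ x.divisors, vonMangoldt n := by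
          rw [Finset.mul_sum]; exact Finset.sum_congr rfl fun n _ => by ring
        rw [this, ArithmeticFunction.vonMangoldt_sum]
        field_simp
      · rw [if_neg hW]
        have : ¬(Q < x ∧ x ≤ R) := fun h => hW h.1
        simp [exitGammaAtom_of_not_mem this]
    rw [Finset.sum_congr rfl hterm, ← Finset.sum_filter]
    refine Finset.sum_le_sum_of_subset_of_nonneg ?_ fun x _ _ => by
      have := exitGammaAtom_nonneg R Q p x; positivity
    intro x hx
    simp only [Finset.mem_filter, Finset.mem_Icc, Finset.mem_Ioc] at hx ⊢
    omega
  have hD : ∑ q ∈ S, (1 / (q.1 : ℝ)) * vonMangoldt q.2 * (g q.1 - g (q.1 / q.2)) ^ 2 =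
      ∑ x ∈ (Icc 1 R).filter (· ∈ Nat.smoothNumbers p),
        (1 / (x : ℝ)) * ∑ n ∈ x.divisors, vonMangoldt n * (g x - g (x / n)) ^ 2 := by
    rw [hS, Finset.sum_sigma]
    refine Finset.sum_congr rfl fun x _ => ?_
    rw [Finset.mul_sum]; exact Finset.sum_congr rfl fun n _ => by ring
  rw [hflat, ← hD]
  have hDnn : 0 ≤ ∑ q ∈ S, (1 / (q.1 : ℝ)) * vonMangoldt q.2 * (g q.1 - g (q.1 / q.2)) ^ 2 :=
    Finset.sum_nonneg fun q _ => mul_nonneg (mul_nonneg (by positivity) ArithmeticFunction.vonMangoldt_nonneg)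
      (sq_nonneg _)
  refine le_trans (Finset.sum_sq_le_sum_mul_sum_of_sq_le_mul S (fun q _ => ?_) (fun q _ => ?_)
    (fun q hq => le_of_eq ?_)) (mul_le_mul_of_nonneg_right hE hDnn)
  · exact mul_nonneg (mul_nonneg (by positivity) ArithmeticFunction.vonMangoldt_nonneg) (sq_nonneg _)
  · exact mul_nonneg (mul_nonneg (by positivity) ArithmeticFunction.vonMangoldt_nonneg) (sq_nonneg _)
  · ring

/-- **The flow half of THEOREMS B/C as a kernel inequality** (every window `2 ≤ Q ≤ R` of the `p`-free atom):
for the pointwise Green bound `Γ ≤ A log R/log x` on `(Q, R]` and every `g`,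
`(Σ_{x∈𝒜, Q<x≤R} g/x − Σ_{b∈𝒜, b≤Q} ν^𝒜(b)g(b))² ≤ A² log²R·(1/(2log²Q) − 1/(2log²R))·D_𝒜(g)`. -/
theorem exit_flow_cauchy_schwarz_atom_explicit {R Q : ℕ} (p : ℕ) (hQ : 2 ≤ Q) (hQR : Q ≤ R)
    {A : ℝ} (hΓU : ∀ x, Q < x → x ≤ R → exitGamma R Q x ≤ A * Real.log R / Real.log x)
    (g : ℕ → ℝ) :
    (∑ x ∈ (Ioc Q R).filter (· ∈ Nat.smoothNumbers p), g x / x -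
        ∑ b ∈ (Icc 1 Q).filter (· ∈ Nat.smoothNumbers p), exitInflowAtom R Q p b * g b) ^ 2 ≤
      A ^ 2 * Real.log R ^ 2 * (1 / (2 * Real.log Q ^ 2) - 1 / (2 * Real.log R ^ 2)) *
        ∑ x ∈ (Icc 1 R).filter (· ∈ Nat.smoothNumbers p),
          (1 / (x : ℝ)) * ∑ n ∈ x.divisors, vonMangoldt n * (g x - g (x / n)) ^ 2 := by
  have h1 := exit_flow_cauchy_schwarz_atom p (by omega) hQR g
  have h2 := (sum_exitGammaAtom_sq_div_le_sum R Q p).trans (sum_exitGamma_sq_div_le hQ hQR hΓU)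
  have hD : 0 ≤ ∑ x ∈ (Icc 1 R).filter (· ∈ Nat.smoothNumbers p),
      (1 / (x : ℝ)) * ∑ n ∈ x.divisors, vonMangoldt n * (g x - g (x / n)) ^ 2 :=
    Finset.sum_nonneg fun x _ => mul_nonneg (by positivity)
      (Finset.sum_nonneg fun n _ => mul_nonneg ArithmeticFunction.vonMangoldt_nonneg (sq_nonneg _))
  exact h1.trans (mul_le_mul_of_nonneg_right h2 hD)

end Summit.RiemannHypothesis.RiemannHypothesis.Theorems.IntegerScrew

end
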